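import Literature.Barriers.BirchSwinnertonDyer.RankNotSumOfLocalInvariantsK1Engine
import HarnessLib

/-!
# `rk E(F₄)` for `E = 480a1` via `ℚ(√-1)`, VIII (`d = 1`): the complete `2`-descent of `E^{(1)}` over `K1`

The complete `2`-descent (Silverman AEC Prop. X.1.4, Example X.1.5) of the twist
`E^{(1)} : y² = x(x + 2)(x - 3)` of `480a1` over `K1 = ℚ(√-1)`, through the engine of file VII:
the local relations of files V–VI (parities at the good primes, the conditions at `2 ± i`,
 the four dyadic conditions at `1 + i`) satisfied by the
coordinates of every point with `y ≠ 0` (`rels_of_point`) have a solution space of dimension `3`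
(`rels_inj`: 3 coordinates separate it), the images of the `2`-torsion points being non-degenerate; hence
`rank_ℤ E^{(1)}(K1) + 2 ≤ 3` (`mordellWeilRank_le`): **`rank E^{(1)}(ℚ(√-1)) ≤ 1`**
(sharp: the `2`-Selmer group of `E^{(1)}/ℚ(√-1)` has `𝔽₂`-dimension `3`). This is one quarter of
"2-descent shows that `rk E/F₄ = 6`" (Dokchitser–Dokchitser 2011, proof of Thm. 2, computed over the
minimal subfield `ℚ(√-1) ⊂ F₄`). Everything is proved; the linear algebra over `𝔽₂` is spelled out by
`linear_combination` in characteristic `2`.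

## References

* T. Dokchitser, V. Dokchitser, *A note on the Mordell–Weil rank modulo `n`*, J. Number Theory
  131 (2011) 1833–1839, arXiv:0910.4588, proof of Thm. 2. [DokchitserDokchitser2011RankModN]
* J. H. Silverman, *The Arithmetic of Elliptic Curves*, 2nd ed., GTM 106 (2009), Ch. X §1,
  Prop. X.1.4, Example X.1.5. [SilvermanAEC2009]
-/

noncomputable section

attribute [-instance] instDecidableEqQuadraticAlgebra

open scoped Classical

namespace Literature.Barriers.BirchSwinnertonDyer.DokchitserDokchitser2011

open QuadraticAlgebra WeierstrassCurve

/-- Mathlib's Gaussian integers `ℤ√-1` (the notation `ℤ[i]` is local to Mathlib's file). -/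
local notation "ℤ[i]" => GaussianInt

namespace DescentOne

/-! ### Constants -/

/-- `2·1`, `3·1`, `5·1` divide `D = 2·3·5·41·73`. [folklore] -/
theorem dvd_D : (2 * ((1 : ℤ) : ℤ[i])) ∣ D ∧ (3 * ((1 : ℤ) : ℤ[i])) ∣ D ∧ (5 * ((1 : ℤ) : ℤ[i])) ∣ D :=
  ⟨Dvd.intro 44895 (by decide), Dvd.intro 29930 (by decide), Dvd.intro 17958 (by decide)⟩

/-- The exponent vector of `1 = ∏ (gen j)^(eD j)`. [folklore] -/
def eD : Fin 8 → ℕ := ![0, 0, 0, 0, 0, 0, 0, 0]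

/-- `1 = genProd eD` in `ℤ[i]`. [folklore] -/
theorem d_eq_genProd : ((1 : ℤ) : ℤ[i]) = genProd eD := by rw [genProd_eq]; decide

/-- The quadratic-residue bit of `1` at `2 ± i`. [folklore] -/
theorem c5 : qrBitZMod 5 (red5a ((1 : ℤ) : ℤ[i])) = 0 ∧ qrBitZMod 5 (red5b ((1 : ℤ) : ℤ[i])) = 0 := by
  constructor <;> exact (qrBitZMod_eq_zero_iff _).mpr ⟨1, by decide⟩

/-! ### The relations -/

/-- **The linear relations of the descent of `E^{(1)}` over `K1`** on a pair of coordinate vectors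
`(c₁, c₂)` (of `b₁ = x`, `b₂ = x + 2`): parities at the good primes, the conditions at `2 ± i`,
the dyadic conditions. [cite: SilvermanAEC2009, Prop. X.1.4] -/
def Rels (c₁ c₂ : Fin 9 → ZMod 2) : Prop :=
  (lin (vP 4) c₁ = 0) ∧
  (lin (vP 4) c₂ = 0) ∧
  (lin (vP 5) c₁ = 0) ∧
  (lin (vP 5) c₂ = 0) ∧
  (lin (vP 6) c₁ = 0) ∧
  (lin (vP 6) c₂ = 0) ∧
  (lin (vP 7) c₁ = 0) ∧
  (lin (vP 7) c₂ = 0) ∧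
  (lin (vP 1) c₂ = 0) ∧
  (lin (vP 2) c₁ = 0) ∧
  (lin (vP 3) c₁ = 0) ∧
  (lin MulBit.qr5a c₁ + lin (vP 2) c₂ = 0) ∧
  (lin MulBit.qr5b c₁ + lin (vP 3) c₂ = 0) ∧
  (lin (vP 0) c₁ + lin (vP 0) c₂ = 0) ∧
  (lin (vP 0) c₁ + lin MulBit.dyRe c₁ + lin MulBit.dyRe c₂ = 0) ∧
  (lin (vP 0) c₁ + lin MulBit.dyNrm c₁ + lin MulBit.dyNrm c₂ = 0) ∧
  (lin MulBit.dyRe c₁ + lin MulBit.dyNrm c₁ + lin MulBit.dyT c₁ + lin MulBit.dyT c₂ = 0)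

/-- **Every point with `y ≠ 0` satisfies the relations.** [cite: SilvermanAEC2009, Prop. X.1.4] -/
theorem rels_of_point (x y : K1) (hy : y ≠ 0)
    (h : y ^ 2 = x * (x + 2 * (1 : ℤ)) * (x - 3 * (1 : ℤ))) : Rels (coord x) (coord (x + 2 * (1 : ℤ))) := by
  obtain ⟨hd2, hd3, hd5⟩ := dvd_D
  obtain ⟨z, n, w, m, hn, hm, hw, hx, hx2, heq⟩ := exists_integral_data h hy
  obtain ⟨hz, hZ2, -⟩ := factors_ne_zero_of_eq hn hw heq
  obtain ⟨⟨a₁, e₁, t₁, ht₁, -, -, hb₁⟩, ⟨a₂, e₂, t₂, ht₂, -, -, hb₂⟩⟩ :=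
    exists_decompositions hd2 hd3 hd5 h hy
  have C1 : ∀ χ : MulBit, lin χ (coord x) = χ z + χ n := fun χ => by
    rw [← χ.onK1_eq_coord a₁ e₁ ht₁ hb₁, hx]; exact χ.onK1_div hz hn
  have C2 : ∀ χ : MulBit, lin χ (coord (x + 2 * (1 : ℤ))) = χ (z + 2 * (1 : ℤ) * n) + χ n :=
    fun χ => by rw [← χ.onK1_eq_coord a₂ e₂ ht₂ hb₂, hx2]; exact χ.onK1_div hZ2 hn
  obtain ⟨c5a, c5b⟩ := c5
  have F5a := five_a_conditions (d := 1) (not_dvd_of_not_norm_dvd (by decide)) hn hm hw heq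
  have F5b := five_b_conditions (d := 1) (not_dvd_of_not_norm_dvd (by decide)) hn hm hw heq
  have Dy := local_dyadic (d := 1) (by decide) hn hm hw heq
  refine ⟨?_, ?_, ?_, ?_, ?_, ?_, ?_, ?_, ?_, ?_, ?_, ?_, ?_, ?_, ?_, ?_, ?_⟩
  · -- par1_4
    rw [← (vP 4).onK1_eq_coord a₁ e₁ ht₁ hb₁]
    exact ofPrime_onK1_b₁_eq_zero h hy 4 (not_dvd_of_not_norm_dvd (by decide))
      (not_dvd_of_not_norm_dvd (by decide))
  · -- par2_4
    rw [← (vP 4).onK1_eq_coord a₂ e₂ ht₂ hb₂]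
    exact ofPrime_onK1_b₂_eq_zero h hy 4 (not_dvd_of_not_norm_dvd (by decide))
      (not_dvd_of_not_norm_dvd (by decide))
  · -- par1_5
    rw [← (vP 5).onK1_eq_coord a₁ e₁ ht₁ hb₁]
    exact ofPrime_onK1_b₁_eq_zero h hy 5 (not_dvd_of_not_norm_dvd (by decide))
      (not_dvd_of_not_norm_dvd (by decide))
  · -- par2_5
    rw [← (vP 5).onK1_eq_coord a₂ e₂ ht₂ hb₂]
    exact ofPrime_onK1_b₂_eq_zero h hy 5 (not_dvd_of_not_norm_dvd (by decide))
      (not_dvd_of_not_norm_dvd (by decide))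
  · -- par1_6
    rw [← (vP 6).onK1_eq_coord a₁ e₁ ht₁ hb₁]
    exact ofPrime_onK1_b₁_eq_zero h hy 6 (not_dvd_of_not_norm_dvd (by decide))
      (not_dvd_of_not_norm_dvd (by decide))
  · -- par2_6
    rw [← (vP 6).onK1_eq_coord a₂ e₂ ht₂ hb₂]
    exact ofPrime_onK1_b₂_eq_zero h hy 6 (not_dvd_of_not_norm_dvd (by decide))
      (not_dvd_of_not_norm_dvd (by decide))
  · -- par1_7
    rw [← (vP 7).onK1_eq_coord a₁ e₁ ht₁ hb₁]
    exact ofPrime_onK1_b₁_eq_zero h hy 7 (not_dvd_of_not_norm_dvd (by decide))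
      (not_dvd_of_not_norm_dvd (by decide))
  · -- par2_7
    rw [← (vP 7).onK1_eq_coord a₂ e₂ ht₂ hb₂]
    exact ofPrime_onK1_b₂_eq_zero h hy 7 (not_dvd_of_not_norm_dvd (by decide))
      (not_dvd_of_not_norm_dvd (by decide))
  · -- par2_1
    rw [← (vP 1).onK1_eq_coord a₂ e₂ ht₂ hb₂]
    exact ofPrime_onK1_b₂_eq_zero h hy 1 (not_dvd_of_not_norm_dvd (by decide))
      (not_dvd_of_not_norm_dvd (by decide))
  · -- par1_2
    rw [← (vP 2).onK1_eq_coord a₁ e₁ ht₁ hb₁]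
    exact ofPrime_onK1_b₁_eq_zero h hy 2 (not_dvd_of_not_norm_dvd (by decide))
      (not_dvd_of_not_norm_dvd (by decide))
  · -- par1_3
    rw [← (vP 3).onK1_eq_coord a₁ e₁ ht₁ hb₁]
    exact ofPrime_onK1_b₁_eq_zero h hy 3 (not_dvd_of_not_norm_dvd (by decide))
      (not_dvd_of_not_norm_dvd (by decide))
  · -- m5a
    simp only [C1, C2]
    rw [vP_eq.2.2.1]
    obtain ⟨-, F⟩ := F5a
    rw [c5a] at F
    linear_combination (norm := (ring_nf; reduce_mod_char)) F
  · -- m5b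
    simp only [C1, C2]
    rw [vP_eq.2.2.2.1]
    obtain ⟨-, F⟩ := F5b
    rw [c5b] at F
    linear_combination (norm := (ring_nf; reduce_mod_char)) F
  · -- dy1
    simp only [C1, C2]
    rw [vP_eq.1]
    linear_combination (norm := (ring_nf; reduce_mod_char)) Dy.1
  · -- dy2
    simp only [C1, C2]
    rw [vP_eq.1]
    linear_combination (norm := (ring_nf; reduce_mod_char)) Dy.2.1
  · -- dy3
    simp only [C1, C2]
    rw [vP_eq.1]
    linear_combination (norm := (ring_nf; reduce_mod_char)) Dy.2.2.1
  · -- dy4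
    simp only [C1, C2]
    linear_combination (norm := (ring_nf; reduce_mod_char)) Dy.2.2.2

/-! ### The linear algebra -/

/-- **The relations have exactly `2^3` solutions**: a solution with vanishing coordinates
`c₁ 0`, `c₁ 1`, `c₁ 2` is zero (Gaussian elimination over `𝔽₂`). [folklore] -/
theorem rels_inj (c₁ c₂ : Fin 9 → ZMod 2) (hR : Rels c₁ c₂)
    (hp0 : c₁ 0 = 0) (hp1 : c₁ 1 = 0) (hp2 : c₁ 2 = 0) : c₁ = 0 ∧ c₂ = 0 := by
  obtain ⟨h1, h2, h3, h4, h5, h6, h7, h8, h9, h10, h11, h12, h13, h14, h15, h16, h17⟩ := hR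
  simp only [lin_vP0, lin_vP1, lin_vP2, lin_vP3, lin_vP4, lin_vP5, lin_vP6, lin_vP7, lin_qr5a, lin_qr5b, lin_dyRe, lin_dyNrm, lin_dyT] at h1 h2 h3 h4 h5 h6 h7 h8 h9 h10 h11 h12 h13 h14 h15 h16 h17
  have x0 : c₁ 0 = 0 := by
    linear_combination hp0
  have x1 : c₁ 1 = 0 := by
    linear_combination hp1
  have x2 : c₁ 2 = 0 := by
    linear_combination hp2
  have x3 : c₁ 3 = 0 := by
    linear_combination h10
  have x4 : c₁ 4 = 0 := by
    linear_combination h11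
  have x5 : c₁ 5 = 0 := by
    linear_combination h1
  have x6 : c₁ 6 = 0 := by
    linear_combination h3
  have x7 : c₁ 7 = 0 := by
    linear_combination h5
  have x8 : c₁ 8 = 0 := by
    linear_combination h7
  have x9 : c₂ 0 = 0 := by
    linear_combination (norm := (ring_nf; reduce_mod_char)) h1 + h3 + h5 + h9 + h11 + h13 + h15 + h17 + hp0
  have x10 : c₂ 1 = 0 := by
    linear_combination (norm := (ring_nf; reduce_mod_char)) h14 + hp1
  have x11 : c₂ 2 = 0 := by
    linear_combination h9
  have x12 : c₂ 3 = 0 := by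
    linear_combination (norm := (ring_nf; reduce_mod_char)) h1 + h3 + h5 + h12 + hp0 + hp2
  have x13 : c₂ 4 = 0 := by
    linear_combination (norm := (ring_nf; reduce_mod_char)) h1 + h3 + h7 + h13 + hp0 + hp1 + hp2
  have x14 : c₂ 5 = 0 := by
    linear_combination h2
  have x15 : c₂ 6 = 0 := by
    linear_combination h4
  have x16 : c₂ 7 = 0 := by
    linear_combination (norm := (ring_nf; reduce_mod_char)) h1 + h3 + h5 + h8 + h9 + h10 + h12 + h17
  have x17 : c₂ 8 = 0 := by
    linear_combination h8
  exact ⟨funext fun j => by fin_cases j <;> assumption, funext fun j => by fin_cases j <;> assumption⟩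

/-! ### The projection and the `2`-torsion -/

/-- The separating coordinates `c₁ 0`, `c₁ 1`, `c₁ 2`. [folklore] -/
def proj : ((Fin 9 → ZMod 2) × (Fin 9 → ZMod 2)) →+ (Fin 3 → ZMod 2) :=
  AddMonoidHom.mk' (fun v => ![v.1 0, v.1 1, v.1 2]) (fun v w => by ext i; fin_cases i <;> rfl)

/-- The values of `proj`. [folklore] -/
theorem proj_apply (v : (Fin 9 → ZMod 2) × (Fin 9 → ZMod 2)) : proj v = ![v.1 0, v.1 1, v.1 2] := rfl

/-- **`rank E^{(1)}(ℚ(√-1)) + 2 ≤ 3`.** [cite: DokchitserDokchitser2011RankModN, proof of Thm. 2] -/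
theorem mordellWeilRank_add_two_le : (Wd 1).mordellWeilRank + 2 ≤ 3 := by
  obtain ⟨hd2, hd3, hd5⟩ := dvd_D
  have hd0 : (1 : ℤ) ≠ 0 := by decide
  obtain ⟨hT1, hT2⟩ := coordPair_torsion hd0 eD d_eq_genProd
  refine mordellWeilRank_Wd_add_two_le hd0 hd2 hd3 hd5 proj (fun v => Rels v.1 v.2)
    (fun x y hy h => rels_of_point x y hy h) (fun v hR hp => ?_) ?_ ?_ ?_ ?_
  · obtain ⟨c₁, c₂⟩ := v
    obtain ⟨h1, h2⟩ := rels_inj c₁ c₂ hR (congrFun hp 0) (congrFun hp 1) (congrFun hp 2)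
    rw [h1, h2]; rfl
  · rw [hT1, proj_apply]; decide
  · rw [hT2, proj_apply]; decide
  · rw [hT1, hT2, proj_apply, proj_apply]; decide
  · rw [hT1, hT2, proj_apply, proj_apply]; decide

end DescentOne

end Literature.Barriers.BirchSwinnertonDyer.DokchitserDokchitser2011

end
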